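import Literature.NumberTheory.GaloisRepresentations.HeckeCharacterArchType
import Literature.NumberTheory.GaloisRepresentations.AlgebraicHeckeCharacterPurity
import Literature.NumberTheory.GaloisRepresentations.HeckeCharacterOfRayClass
import Literature.NumberTheory.NumberFields.ChevalleyUnitCongruence
import Literature.NumberTheory.NumberFields.ChevalleyUnitCongruenceProofs
import Literature.NumberTheory.GaloisRepresentations.HeckeCharacterArchExistence
import Mathlib.Algebra.Module.Injective
import Mathlib.Analysis.SpecialFunctions.Complex.Circle
import HarnessLib

/-!
# Weil's unit criterion for archimedean types (Patrikis 2019, Lemma 2.1.1): proofs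

Topic `NumberTheory/GaloisRepresentations`; namespace `Literature.NumberTheory.GaloisRepresentations`.
Proof file of `HeckeCharacterArchType.lean` (theorems only: no definition, no named fact, no
instance; D-0026).

## §1. Necessity (unconditional)

`HeckeCharacter.HasUnitaryArchType.exists_pow_prod_archUnitaryValue_unit_eq_one`: if a Hecke
character `ψ` of `K` has unitary archimedean type `(m, t)` — `ψ((x,1)) = ∏_w (ι_w x_w/|ι_w x_w|)^{m_w}
|ι_w x_w|^{i t_w}` on `K_∞ˣ` — then for some `M ≥ 1` every global unit `α` satisfies
`(∏_w (ι_w α/|ι_w α|)^{m_w} |ι_w α|^{i t_w})^M = 1`.  This is the (⇒) half of the named fact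
`Patrikis2019_heckeCharacter_archType_iff_units` (Patrikis 2019, Lemma 2.1.1 = Weil 1956), and it
does not use unitarity of `ψ`.  Printed argument (Weil 1956 §1; Neukirch VII §6 (6.13)): `ψ` has a
module of definition `𝔪` (tree: `HeckeCharacter.exists_isModulus`), `u^M ≡ 1 mod 𝔪` for every unit
`u` with `M = #(𝓞_K/𝔪)ˣ` (tree: `HeckeCharacter.exists_unit_pow_sub_one_mem`), and for such a unit
`β = α^M` the principal idele `(β)` is `(β)_∞` times an idele of `I_f^𝔪`, so that
`1 = ψ((β)) = ψ((β)_∞) = ∏_w χ_w(ι_w β) = (∏_w χ_w(ι_w α))^M` (tree: Neukirch's decomposition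
`HeckeCharacter.map_principalIdele_eq`, `map_prod_localUnits_eq_one_of_isModulus`).

## §2–§4. Sufficiency: Weil's extension lemma (unconditional)

`HeckeCharacter.exists_isUnitary_infiniteIdeles_eq` (**Weil 1956, §1**): a continuous unitary
character `Φ` of `(K ⊗ ℝ)ˣ` with `Φ((u)_∞) = 1` for all global units `u ≡ 1 mod 𝔞` (`𝔞 ≠ 0`) is
the infinite component of a unitary Hecke character `ψ`, `ψ((x, 1)) = Φ(x)`.  Construction: on the
subgroup `W = (K ⊗ ℝ)ˣ · (W_𝔞 ∩ 𝕌_K)` of `𝕀_K` (tree: `congruenceIdeles`, `unitIdeles`; a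
neighbourhood of `1`) the character `φ = Φ ∘ (·)_∞` kills `W ∩ Kˣ = {u ∈ 𝓞_Kˣ : u ≡ 1 mod 𝔞}`
(`exists_units_sub_one_mem_of_principalIdele`), so it extends to a character of `𝕀_K` trivial on
`Kˣ` with values in the DIVISIBLE group `S¹` (§2: Baer's criterion over `ℤ`,
`Subgroup.exists_monoidHom_extension_eq_one`; unitarity is then automatic and no finiteness of the
class group is needed), continuous because it agrees with `Φ ∘ (·)_∞` near `1`.  §3 packages
`x ↦ ∏_w (ι_w x_w/|ι_w x_w|)^{m_w} |ι_w x_w|^{i t_w}` as a continuous character of `(K ⊗ ℝ)ˣ`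
(`exists_continuousMonoidHom_archUnitaryValue`), whence
`HeckeCharacter.exists_isUnitary_hasUnitaryArchType_of_congruence`: if the unit-side product kills
a congruence subgroup of `𝓞_Kˣ`, a unitary Hecke character of type `(m, t)` exists.

## §5–§6. The named fact

* `Patrikis2019_heckeCharacter_archType_iff_units_of_chevalley`: the named fact
  `Patrikis2019_heckeCharacter_archType_iff_units` follows from Chevalley's theorem
  `Chevalley1951.thm1_units` (every `(𝓞_Kˣ)^M` contains a congruence subgroup `{u ≡ 1 mod a}`;
  a named fact of the tree, `NumberFields/ChevalleyUnitCongruence.lean`) — this is exactly how the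
  unit condition `(∏_w χ_w(ι_w α))^M = 1` enters Weil's proof.  Conversely the (⇐) half for all
  `(m, t)` implies that every finite-index subgroup of `𝓞_Kˣ` with cyclic quotient is a congruence
  subgroup, so Chevalley's theorem is a genuine prerequisite of `…_holds`.
* `Patrikis2019_heckeCharacter_archType_iff_units_of_finite_units`: for `K` with finite unit group
  (`ℚ`, imaginary quadratic) the criterion holds unconditionally (`𝔞 = (q)` for a large prime `q`).
* §7: the same two reductions for the sibling named fact `HeckeCharacter.exists_of_unitaryArchParams_iff`
  (`HeckeCharacterArchExistence.lean`), whose products are definitionally the ones used here.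

## References

* S. Patrikis, *Variations on a theorem of Tate*, Mem. AMS 258 (2019), no. 1238 = arXiv:1207.6724,
  §2.1, Lemma 2.1.1 (p. 18 of the arXiv version). [Patrikis2019]
* A. Weil, *On a certain type of characters of the idèle-class group of an algebraic
  number-field*, Proc. Int. Symp. Tokyo–Nikko 1955 (1956), 1–7, §1. [Weil1956]
* J. Neukirch, *Algebraic Number Theory*, Grundlehren 322, Springer 1999, Ch. VII §6 (6.11)–(6.13).
  [NeukirchANT1999]
* C. Chevalley, *Deux théorèmes d'arithmétique*, J. Math. Soc. Japan 3 (1951), 36–44, Théorème 1.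
  [ChevalleyDeuxTheoremes1951]
-/

noncomputable section

open scoped NumberField
open NumberField IsDedekindDomain NumberField.InfinitePlace NumberField.InfinitePlace.Completion

namespace Literature.NumberTheory.GaloisRepresentations

universe u

variable {K : Type u} [Field K] [NumberField K]

/-! ### §0. The local characters `z ↦ (z/|z|)^m |z|^{it}` are multiplicative -/

/-- Multiplicativity of `z ↦ (z/|z|)^m |z|^{it}` on `ℂˣ`. [folklore] -/
theorem archUnitaryValue_mul {z z' : ℂ} (hz : z ≠ 0) (hz' : z' ≠ 0) (m : ℤ) (t : ℝ) :
    archUnitaryValue m t (z * z') = archUnitaryValue m t z * archUnitaryValue m t z' := by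
  have h1 : (‖z‖ : ℂ) ≠ 0 := by exact_mod_cast norm_ne_zero_iff.mpr hz
  have h2 : (‖z'‖ : ℂ) ≠ 0 := by exact_mod_cast norm_ne_zero_iff.mpr hz'
  unfold archUnitaryValue
  rw [norm_mul, Complex.ofReal_mul, Complex.mul_cpow_ofReal_nonneg (norm_nonneg _) (norm_nonneg _),
    mul_div_mul_comm, mul_zpow]
  ring

/-- `(zⁿ/|zⁿ|)^m |zⁿ|^{it} = ((z/|z|)^m |z|^{it})ⁿ` for `z ≠ 0`. [folklore] -/
theorem archUnitaryValue_pow {z : ℂ} (hz : z ≠ 0) (m : ℤ) (t : ℝ) (n : ℕ) :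
    archUnitaryValue m t (z ^ n) = archUnitaryValue m t z ^ n := by
  induction n with
  | zero => rw [pow_zero, pow_zero]; simp [archUnitaryValue]
  | succ n ih => rw [pow_succ, archUnitaryValue_mul (pow_ne_zero _ hz) hz, ih, pow_succ]

/-! ### §1. Necessity: the unit relation of a Hecke character of unitary archimedean type -/

omit [NumberField K] in
/-- The embedding of the completion at `w` restricted to `K` (through the infinite part of a
principal idele) is the embedding `σ_w` of `w`. [folklore] -/
theorem extensionEmbedding_globalToInfiniteUnits (w : InfinitePlace K) (k : Kˣ) :
    extensionEmbedding w ((globalToInfiniteUnits K k : InfiniteAdeleRing K) w) =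
      w.embedding (k : K) := by
  rw [val_globalToInfiniteUnits, InfiniteAdeleRing.algebraMap_apply]
  exact extensionEmbedding_coe w (WithAbs.toAbs w.1 (k : K))

namespace HeckeCharacter

/-- For a module of definition `(T, e)` of `χ` and a global unit `u ≡ 1 mod 𝔪(T, e)`, the infinite
part of the principal idele `(u)` is killed by `χ`: `χ((u)_∞) = 1` (Neukirch's decomposition
`(u) = (u)_∞ · ∏_{v ∈ T} ⟨u⟩_v · (unit idele ≡ 1)`, all finite factors in `I_f^𝔪`).
Ref: Neukirch, *Algebraic Number Theory*, Ch. VII §6, proof of (6.13). [folklore] -/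
theorem map_infiniteIdeles_unit_eq_one_of_isModulus {χ : HeckeCharacter K}
    {T : Finset (HeightOneSpectrum (𝓞 K))} {e : HeightOneSpectrum (𝓞 K) → ℕ}
    (hmod : IsModulus χ T e) {u : (𝓞 K)ˣ} (hu : (u : 𝓞 K) - 1 ∈ modulusIdeal T e) :
    χ (infiniteIdeles K (globalToInfiniteUnits K
      (Units.map (algebraMap (𝓞 K) K : 𝓞 K →* K) u))) = 1 := by
  classical
  set k : Kˣ := Units.map (algebraMap (𝓞 K) K : 𝓞 K →* K) u with hk
  have hkval : (k : K) = ((u : 𝓞 K) : K) := rfl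
  have hunit : ∀ v : HeightOneSpectrum (𝓞 K), v.valuation K (k : K) = 1 := fun v => by
    rw [hkval, show ((u : 𝓞 K) : K) = algebraMap (𝓞 K) K (u : 𝓞 K) from rfl,
      HeightOneSpectrum.valuation_eq_one_iff_notMem]
    exact fun h => v.isPrime.ne_top (Ideal.eq_top_of_isUnit_mem _ h (Units.isUnit u))
  have hdec := map_principalIdele_eq hmod k (S := T) subset_rfl (fun v _ => hunit v)
  have hT : ∏ v ∈ T, χ (localUnits v (globalToLocalUnits v k)) = 1 := by
    rw [← map_prod]
    refine map_prod_localUnits_eq_one_of_isModulus hmod (fun v => globalToLocalUnits v k)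
      (fun v _ => ?_) (fun v hv => ?_)
    · rw [val_globalToLocalUnits, valued_algebraMap_adicCompletion]
      exact hunit v
    · rw [val_globalToLocalUnits]
      have hcast : (k : K) - 1 = algebraMap (𝓞 K) K ((u : 𝓞 K) - 1) := by
        rw [map_sub, map_one, hkval]
      rw [← map_one (algebraMap K (v.adicCompletion K)), ← map_sub,
        valued_algebraMap_adicCompletion, hcast, HeightOneSpectrum.valuation_of_algebraMap]
      have hmem : (u : 𝓞 K) - 1 ∈ v.asIdeal ^ (e v + 1) :=
        Ideal.le_of_dvd (pow_dvd_modulusIdeal e hv) hu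
      calc v.intValuation ((u : 𝓞 K) - 1) ≤ WithZero.exp (-((e v + 1 : ℕ) : ℤ)) :=
            (HeightOneSpectrum.intValuation_le_pow_iff_mem v _ (e v + 1)).mpr hmem
        _ ≤ WithZero.exp (-(e v : ℤ)) := WithZero.exp_le_exp.mpr (by push_cast; linarith)
  rwa [hT, mul_one] at hdec

/-- **Necessity half of Weil's unit criterion (Patrikis 2019, Lemma 2.1.1, ⇒).**  If the Hecke
character `ψ` of `K` has unitary archimedean type `(m, t)`, i.e.
`ψ((x, 1)) = ∏_w (ι_w x_w/|ι_w x_w|)^{m_w} |ι_w x_w|^{i t_w}` for every infinite idele `x`, then for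
some positive integer `M` every global unit `α ∈ 𝓞_Kˣ` satisfies
`(∏_w (ι_w α/|ι_w α|)^{m_w} |ι_w α|^{i t_w})^M = 1`.  (Unitarity of `ψ` is not needed.)  Proof as
printed in Weil 1956 §1 / Neukirch VII (6.13): a module of definition `𝔪` of `ψ`
(`exists_isModulus`), `M = #(𝓞_K/𝔪)ˣ` (`exists_unit_pow_sub_one_mem`), and
`1 = ψ((α^M)) = ψ((α^M)_∞) = (∏_w χ_w(ι_w α))^M`.
[cite: Patrikis2019, Lemma 2.1.1 (arXiv:1207.6724 §2.1, p. 18)] -/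
theorem HasUnitaryArchType.exists_pow_prod_archUnitaryValue_unit_eq_one {ψ : HeckeCharacter K}
    {m : InfinitePlace K → ℤ} {t : InfinitePlace K → ℝ} (h : ψ.HasUnitaryArchType m t) :
    ∃ M : ℕ, 0 < M ∧ ∀ α : (𝓞 K)ˣ,
      (∏ w : InfinitePlace K, archUnitaryValue (m w) (t w) (w.embedding ((α : 𝓞 K) : K))) ^ M = 1 := by
  obtain ⟨T, e, hmod⟩ := ψ.exists_isModulus
  obtain ⟨M, hM, hcong⟩ := exists_unit_pow_sub_one_mem (modulusIdeal T e) (modulusIdeal_ne_bot T e)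
  refine ⟨M, hM, fun α => ?_⟩
  have hu : ((α ^ M : (𝓞 K)ˣ) : 𝓞 K) - 1 ∈ modulusIdeal T e := by
    rw [Units.val_pow_eq_pow_val]; exact hcong α
  have h1 := map_infiniteIdeles_unit_eq_one_of_isModulus hmod hu
  set k : Kˣ := Units.map (algebraMap (𝓞 K) K : 𝓞 K →* K) (α ^ M) with hk
  have hkval : (k : K) = ((α : 𝓞 K) : K) ^ M := by
    rw [hk, Units.coe_map, Units.val_pow_eq_pow_val]; rfl
  have key := h (globalToInfiniteUnits K k)
  rw [h1, Units.val_one] at key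
  have hα0 : ∀ w : InfinitePlace K, w.embedding ((α : 𝓞 K) : K) ≠ 0 := fun w =>
    (map_ne_zero _).mpr (by exact_mod_cast Units.ne_zero α)
  rw [← Finset.prod_pow, key]
  refine Finset.prod_congr rfl fun w _ => ?_
  rw [extensionEmbedding_globalToInfiniteUnits, hkval, map_pow, archUnitaryValue_pow (hα0 w)]

end HeckeCharacter

/-- The (⇒) half of `Patrikis2019_heckeCharacter_archType_iff_units`, in the exact shape of the
named fact (the unitarity hypothesis is not used). [cite: Patrikis2019, Lemma 2.1.1] -/
theorem Patrikis2019_heckeCharacter_archType_units_of_exists (K : Type) [Field K] [NumberField K]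
    (m : InfinitePlace K → ℤ) (t : InfinitePlace K → ℝ)
    (h : ∃ ψ : HeckeCharacter K, ψ.IsUnitary ∧ ψ.HasUnitaryArchType m t) :
    ∃ M : ℕ, 0 < M ∧ ∀ α : (𝓞 K)ˣ,
      (∏ w : InfinitePlace K, archUnitaryValue (m w) (t w) (w.embedding ((α : 𝓞 K) : K))) ^ M = 1 := by
  obtain ⟨ψ, -, hψ⟩ := h
  exact hψ.exists_pow_prod_archUnitaryValue_unit_eq_one


/-! ### §2. Extension of characters with values in a divisible group -/

section Extension

variable {G C : Type*} [CommGroup G] [CommGroup C]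

/-- In a group where every element has `n`-th roots for all `n ≥ 1` (e.g. `ℂˣ`, `S¹`), every
element has `m`-th roots for all integers `m ≠ 0`. [folklore] -/
theorem exists_zpow_eq_of_exists_pow_eq (hC : ∀ n : ℕ, 0 < n → ∀ c : C, ∃ d : C, d ^ n = c)
    {m : ℤ} (hm : m ≠ 0) (c : C) : ∃ d : C, d ^ m = c := by
  rcases lt_or_gt_of_ne hm with h | h
  · obtain ⟨d, hd⟩ := hC (-m).toNat (by omega) c⁻¹
    refine ⟨d, ?_⟩
    have h1 : ((-m).toNat : ℤ) = -m := Int.toNat_of_nonneg (by omega)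
    rw [← zpow_natCast, h1, zpow_neg] at hd
    exact inv_injective hd
  · obtain ⟨d, hd⟩ := hC m.toNat (by omega) c
    refine ⟨d, ?_⟩
    have h1 : (m.toNat : ℤ) = m := Int.toNat_of_nonneg h.le
    rw [← zpow_natCast, h1] at hd
    exact hd

/-- **Baer's criterion over `ℤ` for (the additive copy of) a divisible abelian group.**
Ref: Mathlib `Module.Baer.of_divisible` (same proof, with the roots supplied by hypothesis).
[folklore] -/
theorem baer_int_additive_of_exists_pow_eq (hC : ∀ n : ℕ, 0 < n → ∀ c : C, ∃ d : C, d ^ n = c) :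
    Module.Baer ℤ (Additive C) := by
  intro I g
  rcases IsPrincipalIdealRing.principal I with ⟨m, rfl⟩
  rcases eq_or_ne m 0 with rfl | h0
  · refine ⟨0, fun n hn => ?_⟩
    rw [Submodule.span_zero_singleton] at hn
    subst hn
    exact (map_zero g).symm
  set gm : Additive C := g ⟨m, Submodule.subset_span (Set.mem_singleton _)⟩ with hgm
  obtain ⟨d, hd⟩ := exists_zpow_eq_of_exists_pow_eq hC h0 (Additive.toMul gm)
  have hd' : m • Additive.ofMul d = gm := by
    rw [← ofMul_zpow, hd]; rfl
  refine ⟨LinearMap.toSpanSingleton ℤ (Additive C) (Additive.ofMul d), fun n hn => ?_⟩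
  rcases Submodule.mem_span_singleton.mp hn with ⟨n, rfl⟩
  rw [map_zsmul, LinearMap.toSpanSingleton_apply, hd', hgm, ← map_zsmul g, SetLike.mk_smul_mk]

/-- **Characters with values in a divisible abelian group extend from any subgroup** (injectivity
of divisible groups, Baer).  Ref: e.g. Hewitt–Ross, *Abstract Harmonic Analysis* I, (A.7); here from
Mathlib's `Module.Baer.extension_property_addMonoidHom`. [folklore] -/
theorem Subgroup.exists_monoidHom_extension (hC : ∀ n : ℕ, 0 < n → ∀ c : C, ∃ d : C, d ^ n = c)
    (H : Subgroup G) (φ : H →* C) : ∃ Φ : G →* C, ∀ x : H, Φ x = φ x := by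
  have hinj : Function.Injective (MonoidHom.toAdditive H.subtype) := by
    intro a b hab
    have hab' : ((Additive.toMul a : H) : G) = (Additive.toMul b : H) := by
      simpa [MonoidHom.toAdditive] using hab
    exact Additive.toMul.injective (Subtype.ext hab')
  obtain ⟨h, hh⟩ := (baer_int_additive_of_exists_pow_eq hC).extension_property_addMonoidHom
    (MonoidHom.toAdditive H.subtype) hinj (MonoidHom.toAdditive φ)
  refine ⟨MonoidHom.toAdditive.symm h, fun x => ?_⟩
  have hx := DFunLike.congr_fun hh (Additive.ofMul x)
  simp only [AddMonoidHom.coe_comp, Function.comp_apply, MonoidHom.toAdditive_apply_apply,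
    toMul_ofMul, Subgroup.coe_subtype] at hx
  change Additive.toMul (h (Additive.ofMul (x : G))) = φ x
  rw [hx, toMul_ofMul]

/-- **Extension of a character from `W` to `G`, trivially on `P`.**  If `φ : W → C` (`C` divisible)
kills `W ∩ P`, there is a character of `G` extending `φ` and trivial on `P` (define `φ(p w) = φ(w)`
on `P W`, then extend). [folklore] -/
theorem Subgroup.exists_monoidHom_extension_eq_one (hC : ∀ n : ℕ, 0 < n → ∀ c : C, ∃ d : C, d ^ n = c)
    (P W : Subgroup G) (φ : W →* C) (hφ : ∀ w : W, (w : G) ∈ P → φ w = 1) :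
    ∃ Φ : G →* C, (∀ p ∈ P, Φ p = 1) ∧ ∀ w : W, Φ w = φ w := by
  -- choose a decomposition `x = p(x) w(x)` of the elements of `P ⊔ W`
  have hdec : ∀ x : ↥(P ⊔ W), ∃ p ∈ P, ∃ w ∈ W, p * w = (x : G) := fun x =>
    Subgroup.mem_sup.mp x.2
  choose p hp w hw hpw using hdec
  -- `φ` only depends on the class of `w` modulo `P`
  have hkey : ∀ (w₁ w₂ : W) (q : G), q ∈ P → q * (w₁ : G) = w₂ → φ w₁ = φ w₂ := by
    intro w₁ w₂ q hq h
    have hmem : ((w₂ * w₁⁻¹ : W) : G) ∈ P := by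
      have : ((w₂ * w₁⁻¹ : W) : G) = q := by
        rw [Subgroup.coe_mul, Subgroup.coe_inv, ← h, mul_inv_cancel_right]
      rw [this]; exact hq
    have := hφ _ hmem
    rwa [map_mul, map_inv, mul_inv_eq_one, eq_comm] at this
  let ψ : ↥(P ⊔ W) →* C :=
    { toFun := fun x => φ ⟨w x, hw x⟩
      map_one' := by
        have h1 : ((⟨w 1, hw 1⟩ : W) : G) ∈ P := by
          have e : w 1 = (p 1)⁻¹ := by
            have := hpw 1
            rw [Subgroup.coe_one] at this
            exact eq_inv_of_mul_eq_one_right this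
          change w 1 ∈ P
          rw [e]; exact P.inv_mem (hp 1)
        exact hφ _ h1
      map_mul' := fun x y => by
        rw [← map_mul]
        refine (hkey ((⟨w x, hw x⟩ : W) * (⟨w y, hw y⟩ : W)) (⟨w (x * y), hw (x * y)⟩ : W)
          ((p (x * y))⁻¹ * (p x * p y)) (P.mul_mem (P.inv_mem (hp _)) (P.mul_mem (hp x) (hp y))) ?_).symm
        change (p (x * y))⁻¹ * (p x * p y) * (w x * w y) = w (x * y)
        rw [mul_assoc, inv_mul_eq_iff_eq_mul, hpw (x * y), Subgroup.coe_mul, ← hpw x, ← hpw y,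
          mul_mul_mul_comm] }
  obtain ⟨Φ, hΦ⟩ := Subgroup.exists_monoidHom_extension hC (P ⊔ W) ψ
  refine ⟨Φ, fun q hq => ?_, fun w₀ => ?_⟩
  · have hq' : q ∈ P ⊔ W := Subgroup.mem_sup_left hq
    rw [show q = ((⟨q, hq'⟩ : ↥(P ⊔ W)) : G) from rfl, hΦ]
    change φ ⟨w ⟨q, hq'⟩, hw ⟨q, hq'⟩⟩ = 1
    refine hφ _ ?_
    change w ⟨q, hq'⟩ ∈ P
    have e : w ⟨q, hq'⟩ = (p ⟨q, hq'⟩)⁻¹ * q := by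
      rw [eq_inv_mul_iff_mul_eq]; exact hpw ⟨q, hq'⟩
    rw [e]; exact P.mul_mem (P.inv_mem (hp _)) hq
  · have hw₀ : (w₀ : G) ∈ P ⊔ W := Subgroup.mem_sup_right w₀.2
    rw [show (w₀ : G) = ((⟨w₀, hw₀⟩ : ↥(P ⊔ W)) : G) from rfl, hΦ]
    change φ ⟨w ⟨w₀, hw₀⟩, hw ⟨w₀, hw₀⟩⟩ = φ w₀
    exact hkey _ w₀ (p ⟨w₀, hw₀⟩) (hp _) (hpw ⟨w₀, hw₀⟩)

/-- `S¹ ⊂ ℂ` is divisible: every `z ∈ S¹` has an `n`-th root in `S¹` for `n ≥ 1`. [folklore] -/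
theorem Circle.exists_pow_eq (n : ℕ) (hn : 0 < n) (z : Circle) : ∃ y : Circle, y ^ n = z :=
  ⟨Circle.exp (Complex.arg z / n), by
    rw [← Circle.exp_nsmul, nsmul_eq_mul, mul_div_cancel₀ _ (by exact_mod_cast hn.ne'),
      Circle.exp_arg]⟩

end Extension

/-! ### §3. The archimedean character `x ↦ ∏_w (ι_w x_w/|ι_w x_w|)^{m_w} |ι_w x_w|^{i t_w}` -/

/-- `archUnitaryValue m t z ≠ 0` for `z ≠ 0`. [folklore] -/
theorem archUnitaryValue_ne_zero {z : ℂ} (hz : z ≠ 0) (m : ℤ) (t : ℝ) : archUnitaryValue m t z ≠ 0 := by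
  rw [← norm_ne_zero_iff, norm_archUnitaryValue hz]; exact one_ne_zero

/-- `z ↦ (z/|z|)^m |z|^{it}` is continuous on `ℂˣ`. [folklore] -/
theorem continuousAt_archUnitaryValue {z : ℂ} (hz : z ≠ 0) (m : ℤ) (t : ℝ) :
    ContinuousAt (archUnitaryValue m t) z := by
  have hn : ContinuousAt (fun z : ℂ => (‖z‖ : ℂ)) z :=
    Complex.continuous_ofReal.continuousAt.comp continuous_norm.continuousAt
  have hn0 : (‖z‖ : ℂ) ≠ 0 := by exact_mod_cast norm_ne_zero_iff.mpr hz
  unfold archUnitaryValue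
  refine ContinuousAt.mul ?_ ?_
  · exact (continuousAt_id.div hn hn0).zpow₀ m (Or.inl (div_ne_zero hz hn0))
  · exact hn.cpow continuousAt_const (Complex.ofReal_mem_slitPlane.mpr (norm_pos_iff.mpr hz))

/-- **The unitary archimedean character of type `(m, t)` as a continuous character of `(K ⊗ ℝ)ˣ`**:
there is a continuous homomorphism `Φ : (K ⊗ ℝ)ˣ → ℂˣ` with
`Φ(x) = ∏_w (ι_w x_w/|ι_w x_w|)^{m_w} |ι_w x_w|^{i t_w}` (Patrikis 2019 §2.1, display before
Lemma 2.1.1: the product of the local unitary characters). [cite: Patrikis2019, §2.1] -/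
theorem exists_continuousMonoidHom_archUnitaryValue (m : InfinitePlace K → ℤ) (t : InfinitePlace K → ℝ) :
    ∃ Φ : (InfiniteAdeleRing K)ˣ →ₜ* ℂˣ, ∀ x : (InfiniteAdeleRing K)ˣ,
      (Φ x : ℂ) = ∏ w : InfinitePlace K,
        archUnitaryValue (m w) (t w) (extensionEmbedding w ((x : InfiniteAdeleRing K) w)) := by
  have h0 : ∀ (x : (InfiniteAdeleRing K)ˣ) (w : InfinitePlace K),
      extensionEmbedding w ((x : InfiniteAdeleRing K) w) ≠ 0 :=
    fun x w => InfiniteIdele.extensionEmbedding_apply_ne_zero x w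
  let f : (InfiniteAdeleRing K)ˣ →* ℂ :=
    { toFun := fun x => ∏ w : InfinitePlace K,
        archUnitaryValue (m w) (t w) (extensionEmbedding w ((x : InfiniteAdeleRing K) w))
      map_one' := by
        refine Finset.prod_eq_one fun w _ => ?_
        have e : ((1 : (InfiniteAdeleRing K)ˣ) : InfiniteAdeleRing K) w = 1 := rfl
        rw [e, map_one]
        simp [archUnitaryValue]
      map_mul' := fun x y => by
        rw [← Finset.prod_mul_distrib]
        refine Finset.prod_congr rfl fun w _ => ?_
        have e : ((x * y : (InfiniteAdeleRing K)ˣ) : InfiniteAdeleRing K) w =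
            (x : InfiniteAdeleRing K) w * (y : InfiniteAdeleRing K) w := rfl
        rw [e, map_mul, archUnitaryValue_mul (h0 x w) (h0 y w)] }
  have hf : ∀ x, f x ≠ 0 := fun x =>
    Finset.prod_ne_zero_iff.mpr fun w _ => archUnitaryValue_ne_zero (h0 x w) _ _
  have hfc : Continuous f := by
    change Continuous fun x : (InfiniteAdeleRing K)ˣ => ∏ w : InfinitePlace K,
      archUnitaryValue (m w) (t w) (extensionEmbedding w ((x : InfiniteAdeleRing K) w))
    refine continuous_finsetProd _ fun w _ => ?_
    have hc : Continuous fun x : (InfiniteAdeleRing K)ˣ => extensionEmbedding w ((x : InfiniteAdeleRing K) w) :=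
      (isometry_extensionEmbedding w).continuous.comp ((continuous_apply w).comp Units.continuous_val)
    refine continuous_iff_continuousAt.mpr fun x => ?_
    exact (continuousAt_archUnitaryValue (h0 x w) (m w) (t w)).comp
      (f := fun x : (InfiniteAdeleRing K)ˣ => extensionEmbedding w ((x : InfiniteAdeleRing K) w))
      hc.continuousAt
  let Φ₀ : (InfiniteAdeleRing K)ˣ →* ℂˣ := f.toHomUnits
  have hΦ₀ : ∀ x, (Φ₀ x : ℂ) = f x := fun x => rfl
  have hcont : Continuous Φ₀ := by
    refine Units.continuous_iff.mpr ⟨hfc, ?_⟩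
    have e : (fun x : (InfiniteAdeleRing K)ˣ => ((Φ₀ x)⁻¹ : ℂˣ).val) = fun x => (f x)⁻¹ := by
      funext x; rw [Units.val_inv_eq_inv_val]; rfl
    rw [e]
    exact hfc.inv₀ hf
  exact ⟨⟨Φ₀, hcont⟩, fun x => rfl⟩

/-! ### §4. Weil's extension lemma: a unitary character of `(K ⊗ ℝ)ˣ` trivial on a congruence
subgroup of the units is the infinite component of a unitary Hecke character -/

/-- A principal idele which is a unit idele congruent to `1` modulo `𝔞` at the primes of `𝔞` is the
idele of a global unit `u ≡ 1 mod 𝔞`. [folklore] -/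
theorem exists_units_sub_one_mem_of_principalIdele {𝔞 : Ideal (𝓞 K)} (h𝔞 : 𝔞 ≠ ⊥) {k : Kˣ}
    (hU : principalIdele K k ∈ unitIdeles K)
    (hcong : ∀ v : HeightOneSpectrum (𝓞 K), modulusExp 𝔞 v ≠ 0 →
      Valued.v (((principalIdele K k : ideleGroup K) : AdeleRing (𝓞 K) K).2 v - 1) ≤
        WithZero.exp (-(modulusExp 𝔞 v : ℤ))) :
    ∃ u : (𝓞 K)ˣ, Units.map (algebraMap (𝓞 K) K : 𝓞 K →* K) u = k ∧ (u : 𝓞 K) - 1 ∈ 𝔞 := by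
  obtain ⟨u, hu⟩ := exists_units_eq_of_mem_unitIdeles hU
  refine ⟨u, Units.ext hu, mem_of_forall_mem_pow_modulusExp h𝔞 fun v hv => ?_⟩
  have h := hcong v hv
  rw [principalIdele_snd, ← map_one (algebraMap K (v.adicCompletion K)), ← map_sub,
    valued_algebraMap_adicCompletion, ← hu, ← map_one (algebraMap (𝓞 K) K), ← map_sub,
    HeightOneSpectrum.valuation_of_algebraMap] at h
  exact (HeightOneSpectrum.intValuation_le_pow_iff_mem v _ _).mp h

/-- **Weil's extension lemma (Weil 1956, §1; the construction behind Patrikis 2019, Lemma 2.1.1).**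
Let `Φ : (K ⊗ ℝ)ˣ → ℂˣ` be a continuous unitary character and `𝔞 ≠ 0` an ideal of `𝓞 K` such that
`Φ((u)_∞) = 1` for every global unit `u ≡ 1 mod 𝔞`.  Then there is a **unitary Hecke character `ψ`
of `K` with infinite component `Φ`**: `ψ((x, 1)) = Φ(x)` for all `x ∈ (K ⊗ ℝ)ˣ`.
Construction: on the open subgroup `W = (K ⊗ ℝ)ˣ × ∏_v U_v^{(𝔞)}` of `𝕀_K` put `φ(w) = Φ(w_∞)`; it
kills `W ∩ Kˣ = {u ∈ 𝓞_Kˣ : u ≡ 1 mod 𝔞}` (`exists_units_sub_one_mem_of_principalIdele`), hence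
extends to a character of `𝕀_K/Kˣ` with values in the divisible group `S¹`
(`Subgroup.exists_monoidHom_extension_eq_one`), continuous because `W` is a neighbourhood of `1`
(tree: `congruenceIdeles_mem_nhds_one`, `isOpen_unitIdeles`).
[cite: Weil1956, §1] [cite: Patrikis2019, Lemma 2.1.1] -/
theorem HeckeCharacter.exists_isUnitary_infiniteIdeles_eq (Φ : (InfiniteAdeleRing K)ˣ →ₜ* ℂˣ)
    (hΦ : ∀ x, ‖(Φ x : ℂ)‖ = 1) {𝔞 : Ideal (𝓞 K)} (h𝔞 : 𝔞 ≠ ⊥)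
    (hker : ∀ u : (𝓞 K)ˣ, (u : 𝓞 K) - 1 ∈ 𝔞 →
      Φ (globalToInfiniteUnits K (Units.map (algebraMap (𝓞 K) K : 𝓞 K →* K) u)) = 1) :
    ∃ ψ : HeckeCharacter K, ψ.IsUnitary ∧ ∀ x : (InfiniteAdeleRing K)ˣ, ψ (infiniteIdeles K x) = Φ x := by
  classical
  -- `Φ` with values in `S¹`
  let Φc : (InfiniteAdeleRing K)ˣ →* Circle :=
    { toFun := fun x => ⟨(Φ x : ℂ), mem_sphere_zero_iff_norm.mpr (hΦ x)⟩
      map_one' := Circle.ext (by simp)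
      map_mul' := fun x y => Circle.ext (by simp) }
  have hΦc : ∀ x, ((Φc x : Circle) : ℂ) = (Φ x : ℂ) := fun x => rfl
  -- the subgroup `W = (K ⊗ ℝ)ˣ · (W_𝔞 ∩ 𝕌_K)` and the character `φ = Φ ∘ (·)_∞` on it
  set W : Subgroup (ideleGroup K) :=
    (congruenceIdeles 𝔞 ⊓ unitIdeles K) ⊔ (infiniteIdeles K).range with hWdef
  have hWmem : ∀ x ∈ W, x ∈ unitIdeles K ∧ ∀ v : HeightOneSpectrum (𝓞 K), modulusExp 𝔞 v ≠ 0 →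
      Valued.v ((x : AdeleRing (𝓞 K) K).2 v - 1) ≤ WithZero.exp (-(modulusExp 𝔞 v : ℤ)) := by
    intro x hx
    obtain ⟨y, ⟨hyc, hyu⟩, z, ⟨s, rfl⟩, rfl⟩ := Subgroup.mem_sup.mp hx
    have hsu : infiniteIdeles K s ∈ unitIdeles K := fun v => by
      rw [infiniteIdeles_snd]; exact map_one _
    refine ⟨(unitIdeles K).mul_mem hyu hsu, fun v hv => ?_⟩
    rw [ideleGroup_val_snd_mul, infiniteIdeles_snd, mul_one]
    exact hyc.1 v hv
  have hWnhds : (W : Set (ideleGroup K)) ∈ nhds (1 : ideleGroup K) := by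
    refine Filter.mem_of_superset (Filter.inter_mem (congruenceIdeles_mem_nhds_one h𝔞)
      ((isOpen_unitIdeles K).mem_nhds (unitIdeles K).one_mem)) fun x hx => ?_
    exact Subgroup.mem_sup_left ⟨hx.1, hx.2⟩
  let φ : W →* Circle := (Φc.comp (HeckeCharacter.infPart K)).comp W.subtype
  have hφ : ∀ w : W, (w : ideleGroup K) ∈ principalIdeles K → φ w = 1 := by
    rintro ⟨x, hx⟩ ⟨k, hk⟩
    obtain ⟨hxu, hxc⟩ := hWmem x hx
    have hk' : principalIdele K k = x := hk
    rw [← hk'] at hxu hxc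
    obtain ⟨u, huk, hu⟩ := exists_units_sub_one_mem_of_principalIdele h𝔞 hxu hxc
    apply Circle.ext
    change (Φ (HeckeCharacter.infPart K x) : ℂ) = 1
    rw [← hk', HeckeCharacter.infPart_principalIdele, ← huk, hker u hu, Units.val_one]
  -- extend to a character of `𝕀_K / Kˣ` with values in `S¹`
  obtain ⟨Ψ, hΨP, hΨW⟩ := Subgroup.exists_monoidHom_extension_eq_one Circle.exists_pow_eq
    (principalIdeles K) W φ hφ
  let ψ₀ : ideleGroup K →* ℂˣ := Circle.toUnits.comp Ψ
  have hψ₀W : ∀ x ∈ W, ψ₀ x = Φ (HeckeCharacter.infPart K x) := fun x hx => by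
    apply Units.ext
    change (((Ψ x : Circle) : ℂ)) = (Φ (HeckeCharacter.infPart K x) : ℂ)
    rw [show x = ((⟨x, hx⟩ : W) : ideleGroup K) from rfl, hΨW]
    rfl
  -- continuity: `ψ₀ = Φ ∘ (·)_∞` near `1`
  have hcont : Continuous ψ₀ := by
    refine continuous_of_continuousAt_one ψ₀ ?_
    have hc : Continuous fun x : ideleGroup K => Φ (HeckeCharacter.infPart K x) :=
      Φ.continuous.comp HeckeCharacter.continuous_infPart
    refine (hc.continuousAt.congr ?_)
    exact Filter.eventuallyEq_of_mem hWnhds fun x hx => (hψ₀W x hx).symm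
  let ψ : HeckeCharacter K := ⟨⟨ψ₀, hcont⟩, fun x hx => by
    change Circle.toUnits (Ψ x) = 1
    rw [hΨP x hx, map_one]⟩
  have hψ : ∀ x, ψ x = ψ₀ x := fun x => rfl
  refine ⟨ψ, fun x => ?_, fun x => ?_⟩
  · rw [hψ]
    exact Circle.norm_coe (Ψ x)
  · rw [hψ, hψ₀W _ (Subgroup.mem_sup_right ⟨x, rfl⟩), HeckeCharacter.infPart_infiniteIdeles]

/-- **Weil's extension lemma for archimedean types.**  If the character
`x ↦ ∏_w (ι_w x_w/|ι_w x_w|)^{m_w} |ι_w x_w|^{i t_w}` of `(K ⊗ ℝ)ˣ` kills the global units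
`u ≡ 1 mod 𝔞` for some nonzero ideal `𝔞` — i.e. its kernel on `𝓞_Kˣ` is a congruence subgroup —
then there is a unitary Hecke character of `K` of unitary archimedean type `(m, t)`.  This is the
(⇐) half of Patrikis 2019, Lemma 2.1.1 up to Chevalley's theorem that every finite-index subgroup
of `𝓞_Kˣ` is a congruence subgroup; it applies unconditionally when the unit condition is already
of congruence type (e.g. `K` imaginary quadratic or `ℚ`). [cite: Patrikis2019, Lemma 2.1.1]
[cite: Weil1956, §1] -/
theorem HeckeCharacter.exists_isUnitary_hasUnitaryArchType_of_congruence
    (m : InfinitePlace K → ℤ) (t : InfinitePlace K → ℝ) {𝔞 : Ideal (𝓞 K)} (h𝔞 : 𝔞 ≠ ⊥)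
    (hker : ∀ u : (𝓞 K)ˣ, (u : 𝓞 K) - 1 ∈ 𝔞 →
      ∏ w : InfinitePlace K, archUnitaryValue (m w) (t w) (w.embedding ((u : 𝓞 K) : K)) = 1) :
    ∃ ψ : HeckeCharacter K, ψ.IsUnitary ∧ ψ.HasUnitaryArchType m t := by
  obtain ⟨Φ, hΦ⟩ := exists_continuousMonoidHom_archUnitaryValue (K := K) m t
  have hΦ1 : ∀ x, ‖(Φ x : ℂ)‖ = 1 := fun x => by
    rw [hΦ, norm_prod]
    exact Finset.prod_eq_one fun w _ =>
      norm_archUnitaryValue (InfiniteIdele.extensionEmbedding_apply_ne_zero x w) _ _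
  have hkerΦ : ∀ u : (𝓞 K)ˣ, (u : 𝓞 K) - 1 ∈ 𝔞 →
      Φ (globalToInfiniteUnits K (Units.map (algebraMap (𝓞 K) K : 𝓞 K →* K) u)) = 1 := by
    intro u hu
    apply Units.ext
    rw [hΦ, Units.val_one, ← hker u hu]
    refine Finset.prod_congr rfl fun w _ => ?_
    rw [extensionEmbedding_globalToInfiniteUnits]
    rfl
  obtain ⟨ψ, hψu, hψ⟩ := HeckeCharacter.exists_isUnitary_infiniteIdeles_eq Φ hΦ1 h𝔞 hkerΦ
  exact ⟨ψ, hψu, fun x => by rw [hψ x, hΦ x]⟩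


/-! ### §5. Weil's criterion from Chevalley's congruence-subgroup theorem for units -/

/-- The unit-side product for a power of a unit: `∏_w χ_w(ι_w(u^M)) = (∏_w χ_w(ι_w u))^M`.
[folklore] -/
theorem prod_archUnitaryValue_embedding_unit_pow (m : InfinitePlace K → ℤ) (t : InfinitePlace K → ℝ)
    (u : (𝓞 K)ˣ) (M : ℕ) :
    ∏ w : InfinitePlace K, archUnitaryValue (m w) (t w) (w.embedding (((u ^ M : (𝓞 K)ˣ) : 𝓞 K) : K)) =
      (∏ w : InfinitePlace K, archUnitaryValue (m w) (t w) (w.embedding ((u : 𝓞 K) : K))) ^ M := by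
  rw [← Finset.prod_pow]
  refine Finset.prod_congr rfl fun w _ => ?_
  have h0 : w.embedding ((u : 𝓞 K) : K) ≠ 0 :=
    (map_ne_zero _).mpr (by exact_mod_cast Units.ne_zero u)
  rw [Units.val_pow_eq_pow_val, RingOfIntegers.coe_eq_algebraMap, map_pow, map_pow,
    ← RingOfIntegers.coe_eq_algebraMap, archUnitaryValue_pow h0]

/-- **Patrikis 2019, Lemma 2.1.1 from Chevalley 1951, Théorème 1.**  Granting Chevalley's theorem
that the `M`-th powers of `𝓞_Kˣ` contain a congruence subgroup `{u ≡ 1 mod a}`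
(`Chevalley1951.thm1_units`, a named fact of the tree), Weil's unit criterion holds: (⇒) is
`Patrikis2019_heckeCharacter_archType_units_of_exists` (unconditional); for (⇐), the unit condition
`(∏_w χ_w(ι_w α))^M = 1` says that `χ_∞` kills `(𝓞_Kˣ)^M ⊇ {u ≡ 1 mod a}`, and Weil's extension
lemma `HeckeCharacter.exists_isUnitary_hasUnitaryArchType_of_congruence` applies with `𝔞 = (a)`.
[cite: Patrikis2019, Lemma 2.1.1] [cite: ChevalleyDeuxTheoremes1951, Thm 1 (p. 36)] -/
theorem Patrikis2019_heckeCharacter_archType_iff_units_of_chevalley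
    (hC : _root_.Literature.NumberTheory.NumberFields.Chevalley1951.thm1_units) :
    Patrikis2019_heckeCharacter_archType_iff_units := by
  intro K _ _ m t
  refine ⟨Patrikis2019_heckeCharacter_archType_units_of_exists K m t, fun ⟨M, hM, hunits⟩ => ?_⟩
  obtain ⟨a, ha, -, hpow⟩ := hC K M hM 1 one_pos
  have ha0 : (a : 𝓞 K) ≠ 0 := Nat.cast_ne_zero.mpr ha.ne'
  refine HeckeCharacter.exists_isUnitary_hasUnitaryArchType_of_congruence m t
    (𝔞 := Ideal.span {(a : 𝓞 K)}) ?_ fun u hu => ?_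
  · rw [Ne, Ideal.span_singleton_eq_bot]
    exact ha0
  · obtain ⟨w, rfl⟩ := hpow u (Ideal.mem_span_singleton.mp hu)
    rw [prod_archUnitaryValue_embedding_unit_pow]
    exact hunits w


/-! ### §6. Unit rank zero: Weil's criterion unconditionally -/

/-- **Weil's unit criterion for number fields with finite unit group** (`K = ℚ` or `K` imaginary
quadratic), unconditionally: here the kernel condition is automatically of congruence type — for a
rational prime `q` exceeding every `|N(u - 1)|` (`u ≠ 1` a unit) no unit `u ≠ 1` is `≡ 1 mod q`, so
Weil's extension lemma applies with `𝔞 = (q)` and Chevalley's theorem is not needed.  (This is the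
case of Patrikis 2019, Lemma 2.1.1 consumed over `ℚ(ζ₃)` by the Langlands summit's
`HalfIntegralTwistCM` analysis.) [cite: Patrikis2019, Lemma 2.1.1] -/
theorem Patrikis2019_heckeCharacter_archType_iff_units_of_finite_units (K : Type) [Field K]
    [NumberField K] [Finite (𝓞 K)ˣ] (m : InfinitePlace K → ℤ) (t : InfinitePlace K → ℝ) :
    (∃ ψ : HeckeCharacter K, ψ.IsUnitary ∧ ψ.HasUnitaryArchType m t) ↔
      ∃ M : ℕ, 0 < M ∧ ∀ α : (𝓞 K)ˣ,
        (∏ w : InfinitePlace K, archUnitaryValue (m w) (t w) (w.embedding ((α : 𝓞 K) : K))) ^ M = 1 := by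
  classical
  refine ⟨Patrikis2019_heckeCharacter_archType_units_of_exists K m t, fun _ => ?_⟩
  haveI : Fintype (𝓞 K)ˣ := Fintype.ofFinite _
  -- a rational prime `q` exceeding every `|N(u - 1)|`, `u ≠ 1` a unit
  set S : Finset (𝓞 K)ˣ := Finset.univ.filter fun u => u ≠ 1 with hS
  set P : ℕ := ∏ u ∈ S, (Algebra.norm ℤ ((u : 𝓞 K) - 1)).natAbs with hP
  have hne : ∀ u ∈ S, (u : 𝓞 K) - 1 ≠ 0 := fun u hu =>
    sub_ne_zero.mpr fun e => (Finset.mem_filter.mp hu).2 (Units.ext e)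
  have hP0 : 0 < P :=
    Finset.prod_pos fun u hu => Int.natAbs_pos.mpr (Algebra.norm_ne_zero_iff.mpr (hne u hu))
  obtain ⟨q, hqP, hq⟩ := Nat.exists_infinite_primes (P + 1)
  have hq0 : (q : 𝓞 K) ≠ 0 := Nat.cast_ne_zero.mpr hq.ne_zero
  have hnot : ∀ u ∈ S, ¬ ((q : ℤ) ∣ Algebra.norm ℤ ((u : 𝓞 K) - 1)) := by
    intro u hu hdvd
    have h1 : q ∣ P :=
      (Int.natCast_dvd.mp (Int.dvd_natAbs.mpr hdvd)).trans (Finset.dvd_prod_of_mem _ hu)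
    have := Nat.le_of_dvd hP0 h1
    omega
  refine HeckeCharacter.exists_isUnitary_hasUnitaryArchType_of_congruence m t
    (𝔞 := Ideal.span {(q : 𝓞 K)}) ?_ fun u hu => ?_
  · rw [Ne, Ideal.span_singleton_eq_bot]
    exact hq0
  · have hu1 : u = 1 := by
      by_contra hne1
      refine hnot u (Finset.mem_filter.mpr ⟨Finset.mem_univ _, hne1⟩) ?_
      have hdvd : (q : 𝓞 K) ∣ (u : 𝓞 K) - 1 := Ideal.mem_span_singleton.mp hu
      have h2 := map_dvd (Algebra.norm ℤ) hdvd
      have hq' : (q : 𝓞 K) = algebraMap ℤ (𝓞 K) (q : ℤ) := by simp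
      rw [hq', Algebra.norm_algebraMap] at h2
      exact (dvd_pow_self (q : ℤ) Module.finrank_pos.ne').trans h2
    subst hu1
    refine Finset.prod_eq_one fun w _ => ?_
    simp [archUnitaryValue]


/-! ### §7. The sibling named fact `HeckeCharacter.exists_of_unitaryArchParams_iff` -/

/-- The sibling named fact `HeckeCharacter.exists_of_unitaryArchParams_iff`
(`HeckeCharacterArchExistence.lean`: the same Lemma 2.1.1, typed with `InfiniteIdele.unitaryArchChar`
/ `unitArchProduct` and without repeating unitarity on the left) also follows from Chevalley's
theorem: its two products are definitionally the `archUnitaryValue` products, the (⇒) half never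
used unitarity, and the (⇐) half produces a unitary character anyway.
[cite: Patrikis2019, Lemma 2.1.1] [cite: ChevalleyDeuxTheoremes1951, Thm 1 (p. 36)] -/
theorem HeckeCharacter.exists_of_unitaryArchParams_iff_of_chevalley
    (hC : _root_.Literature.NumberTheory.NumberFields.Chevalley1951.thm1_units) :
    HeckeCharacter.exists_of_unitaryArchParams_iff := by
  intro K _ _ m t
  have e2 : ∀ α : (𝓞 K)ˣ, unitArchProduct K m t α =
      ∏ w : InfinitePlace K, archUnitaryValue (m w) (t w) (w.embedding ((α : 𝓞 K) : K)) :=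
    fun α => rfl
  constructor
  · rintro ⟨χ, hχ⟩
    have hχ' : χ.HasUnitaryArchType m t := fun x => hχ x
    obtain ⟨M, hM, h⟩ := hχ'.exists_pow_prod_archUnitaryValue_unit_eq_one
    exact ⟨M, hM, fun α => by rw [e2]; exact h α⟩
  · rintro ⟨M, hM, h⟩
    obtain ⟨ψ, -, hψ⟩ := (Patrikis2019_heckeCharacter_archType_iff_units_of_chevalley hC K m t).2
      ⟨M, hM, fun α => by rw [← e2]; exact h α⟩
    exact ⟨ψ, fun x => hψ x⟩

/-- Likewise unconditionally for number fields with finite unit group. [cite: Patrikis2019, Lemma 2.1.1] -/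
theorem HeckeCharacter.exists_of_unitaryArchParams_iff_of_finite_units (K : Type) [Field K]
    [NumberField K] [Finite (𝓞 K)ˣ] (m : InfinitePlace K → ℤ) (t : InfinitePlace K → ℝ) :
    (∃ χ : HeckeCharacter K, ∀ x : (InfiniteAdeleRing K)ˣ,
        (χ (infiniteIdeles K x) : ℂ) = InfiniteIdele.unitaryArchChar m t x) ↔
      ∃ M : ℕ, 0 < M ∧ ∀ α : (𝓞 K)ˣ, unitArchProduct K m t α ^ M = 1 := by
  have e2 : ∀ α : (𝓞 K)ˣ, unitArchProduct K m t α =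
      ∏ w : InfinitePlace K, archUnitaryValue (m w) (t w) (w.embedding ((α : 𝓞 K) : K)) :=
    fun α => rfl
  constructor
  · rintro ⟨χ, hχ⟩
    have hχ' : χ.HasUnitaryArchType m t := fun x => hχ x
    obtain ⟨M, hM, h⟩ := hχ'.exists_pow_prod_archUnitaryValue_unit_eq_one
    exact ⟨M, hM, fun α => by rw [e2]; exact h α⟩
  · rintro ⟨M, hM, h⟩
    obtain ⟨ψ, -, hψ⟩ := (Patrikis2019_heckeCharacter_archType_iff_units_of_finite_units K m t).2
      ⟨M, hM, fun α => by rw [← e2]; exact h α⟩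
    exact ⟨ψ, fun x => hψ x⟩

/-! ### §8. Discharges

Chevalley's congruence-subgroup theorem for units is now a theorem of the tree
(`Chevalley1951.thm1_units_holds`, `Literature.NumberTheory.NumberFields.ChevalleyUnitCongruenceProofs`,
[cite: ChevalleyDeuxTheoremes1951, Thm 1 (p. 36)]), so §5 and §7 give the two named facts outright. -/

/-- **Weil's unit criterion (Patrikis 2019, Lemma 2.1.1), discharged.** For a number field `K` and
parameters `(m_w, t_w)_w`, a unitary Hecke character with archimedean component
`x ↦ ∏_w (ι_w x_w/|ι_w x_w|)^{m_w} |ι_w x_w|^{i t_w}` exists iff some power `M > 0` of this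
character kills the global units.  Proof: §1 (necessity, via a module of definition) and §§2–5
(sufficiency: Weil's extension of a character of `(K ⊗ ℝ)ˣ · ∏_v U_v(𝔞)` trivial on the
congruence subgroup of units, the congruence subgroup being supplied by Chevalley's theorem
`Chevalley1951.thm1_units_holds`).
[cite: Patrikis2019, Lemma 2.1.1] [cite: ChevalleyDeuxTheoremes1951, Thm 1 (p. 36)] -/
theorem Patrikis2019_heckeCharacter_archType_iff_units_holds :
    Patrikis2019_heckeCharacter_archType_iff_units :=
  Patrikis2019_heckeCharacter_archType_iff_units_of_chevalley
    _root_.Literature.NumberTheory.NumberFields.Chevalley1951.thm1_units_holds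

/-- The sibling named fact `HeckeCharacter.exists_of_unitaryArchParams_iff` (same lemma, phrased with
`InfiniteIdele.unitaryArchChar` / `unitArchProduct` and without the unitarity clause), discharged
via §7 and `Chevalley1951.thm1_units_holds`.
[cite: Patrikis2019, Lemma 2.1.1] [cite: ChevalleyDeuxTheoremes1951, Thm 1 (p. 36)] -/
theorem HeckeCharacter.exists_of_unitaryArchParams_iff_holds :
    HeckeCharacter.exists_of_unitaryArchParams_iff :=
  HeckeCharacter.exists_of_unitaryArchParams_iff_of_chevalley
    _root_.Literature.NumberTheory.NumberFields.Chevalley1951.thm1_units_holds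

end Literature.NumberTheory.GaloisRepresentations
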